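import Mathlib
import HarnessLib
import Literature.Probability.Percolation.BlockResampling
import Literature.Probability.Percolation.InequalitiesProofs
import Summits.CriticalPhenomena.PercolationContinuityZ3.Theorems.PercTreeValueTetrahedronHarrisGapStubCondHarris
import Summits.CriticalPhenomena.PercolationContinuityZ3.Theorems.PercTreeValueTetrahedronHarrisGapReduction

/-!
# `integral_blockCondProb_mul_antitone` of line `SketchIdeator1` (crux `TetrahedronHarrisGap`,
# stmt-CriticalPhenomena-7799): the harvested mixed moment is monotone under coarsening of the window

Registered sub-goal `integral_blockCondProb_mul_antitone` of the lead's skeleton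
`Cruxes/TetrahedronHarrisGap/Lines/SketchIdeator1.lean` (card `corner-ball-total-covariance`, rev 5),
stated DEF-FREE over tree declarations and landed. No new definitions.

Statement. For Bernoulli bond percolation `P_p = bondPercolation G p` on a countable simple graph `G`,
nested finite blocks of edges `B ⊆ B'` and two increasing measurable events `A, A'`,

  `∫ P_p(A | ω off B') · P_p(A' | ω off B') dP_p(ω) ≤ ∫ P_p(A | ω off B) · P_p(A' | ω off B) dP_p(ω)`,

where `P_p(E | ω off B) = blockCondProb G p B E ω` is the written-out conditional probability of
`BlockResampling.lean` (`f_B := P_p(A | · off B)` is the influence of the window `Bᶜ` on `A`; the mixed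
moment `∫ f_B g_B` can only drop when the window shrinks).  The case `B = ∅` (`f_∅ = 𝟙_A`) is the landed
`integral_blockCondProb_mul_blockCondProb_le` (`…StubCondHarris.lean`).

Proof.
* TOWER for nested blocks (`blockCondProb_eq_integral_of_subset`): for `B ⊆ B'` and every `ω`,
  `f_{B'}(ω) = ∫ f_B(ω ∖ B' ∪ obs ζ B') dP_p(ζ)`.  Indeed, unfolding `f_B` and using the gluing identity
  `(ω ∖ B' ∪ obs ζ B') ∖ B ∪ η = ω ∖ B' ∪ obs (ζ ∖ B ∪ η) B'` (`sdiff_union_obs_sdiff_union`, `η ⊆ B ⊆ B'`),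
  the integrand is the block average over `B` (in the variable `ζ`) of `Φ ζ := 𝟙_A(ω ∖ B' ∪ obs ζ B')`, whose
  integral is `∫ Φ dP_p = P_p{ζ | ω ∖ B' ∪ obs ζ B' ∈ A} = f_{B'}(ω)` (`integral_sum_powerset_eq`,
  `blockCondProb_eq_real`).
* CONDITIONAL HARRIS (`blockCondProb_mul_blockCondProb_le_sum_of_subset`): for fixed `ω` the maps
  `ζ ↦ f_B(ω ∖ B' ∪ obs ζ B')`, `ζ ↦ g_B(ω ∖ B' ∪ obs ζ B')` are monotone (`CornerBall.blockCondProb_mono` and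
  `monotone_sdiff_union_obs`) and `[0,1]`-valued, so `harris_fkg_integral_holds` gives
  `f_{B'}(ω) g_{B'}(ω) ≤ ∫ (f_B g_B)(ω ∖ B' ∪ obs ζ B') dP_p(ζ) = Σ_{ξ ⊆ B'} P_p(obs B' = ξ) (f_B g_B)(ω ∖ B' ∪ ξ)`
  (`integral_comp_obs_eq_sum`).
* Integrate over `ω` (`integral_mono`) and resample the block: `∫ Σ_{ξ ⊆ B'} P_p(obs B' = ξ) (f_B g_B)(ω ∖ B' ∪ ξ) dP_p
  = ∫ f_B g_B dP_p` (`integral_sum_powerset_eq`).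
-/

noncomputable section

namespace Summit.CriticalPhenomena.PercolationContinuityZ3.Theorems.TetrahedronHarrisGap

open MeasureTheory
open Literature.Probability.Percolation Literature.Probability.LatticeModels

section General

variable {V : Type*}

/-- **Gluing identity for nested blocks.** For `η ⊆ B ⊆ B'`: modifying the glued configuration
`ω ∖ B' ∪ obs ζ B'` inside the smaller block `B` by `η` is gluing the observation on `B'` of the modified
sample `ζ ∖ B ∪ η`: `(ω ∖ B' ∪ obs ζ B') ∖ B ∪ η = ω ∖ B' ∪ obs (ζ ∖ B ∪ η) B'`. -/
theorem sdiff_union_obs_sdiff_union {B B' η : Finset (Sym2 V)} (hB : B ⊆ B') (hη : η ⊆ B)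
    (ω ζ : BondConfig V) :
    (ω \ ↑B' ∪ ↑(obs ζ B')) \ ↑B ∪ ↑η = ω \ ↑B' ∪ ↑(obs (ζ \ ↑B ∪ ↑η) B') := by
  ext e
  simp only [Set.mem_union, Set.mem_sdiff, Finset.mem_coe, mem_obs_iff]
  have h1 : e ∈ η → e ∈ B := fun h => hη h
  have h2 : e ∈ B → e ∈ B' := fun h => hB h
  tauto

/-- The gluing map `ζ ↦ ω ∖ B' ∪ obs ζ B'` is monotone in the sample `ζ`. -/
theorem monotone_sdiff_union_obs (B' : Finset (Sym2 V)) (ω : BondConfig V) :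
    Monotone fun ζ : BondConfig V => ω \ (↑B' : Set (Sym2 V)) ∪ ↑(obs ζ B') := by
  intro ζ ζ' hle
  refine Set.union_subset_union_right _ (Finset.coe_subset.2 fun e he => ?_)
  exact mem_obs_iff.2 ⟨(mem_obs_iff.1 he).1, hle (mem_obs_iff.1 he).2⟩

variable [Countable V] (G : SimpleGraph V) (p : unitInterval)

/-- **Tower property for nested blocks, pointwise.** For `B ⊆ B'`, every event `E` and every `ω`:
`P_p(E | ω off B') = ∫ P_p(E | (ω ∖ B' ∪ obs ζ B') off B) dP_p(ζ)` — resampling the big block `B'` and then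
averaging over the small block `B` is averaging over `B'` (finite Fubini over `B` in the sample variable `ζ`,
`integral_sum_powerset_eq`, and `blockCondProb_eq_real`). -/
theorem blockCondProb_eq_integral_of_subset {B B' : Finset (Sym2 V)} (hB : B ⊆ B')
    (E : Set (BondConfig V)) (ω : BondConfig V) :
    blockCondProb G p B' E ω =
      ∫ ζ, blockCondProb G p B E (ω \ ↑B' ∪ ↑(obs ζ B')) ∂(bondPercolation G p) := by
  -- the glued indicator, as a function of the sample `ζ`
  set Φ : BondConfig V → ℝ := fun ζ => E.indicator 1 (ω \ ↑B' ∪ ↑(obs ζ B')) with hΦ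
  have hΦm : Measurable Φ :=
    measurable_comp_obs B' (fun ξ => E.indicator (1 : BondConfig V → ℝ) (ω \ ↑B' ∪ ↑ξ))
  have hΦ1 : ∀ ζ, |Φ ζ| ≤ 1 := fun ζ => abs_indicator_one_le E _
  -- the integrand is the block average over `B` of `Φ`
  have hpt : ∀ ζ : BondConfig V, blockCondProb G p B E (ω \ ↑B' ∪ ↑(obs ζ B')) =
      ∑ η ∈ B.powerset, (bondPercolation G p).real {ζ' | obs ζ' B = η} * Φ (ζ \ ↑B ∪ ↑η) := by
    intro ζ
    unfold blockCondProb
    refine Finset.sum_congr rfl fun η hη => ?_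
    rw [sdiff_union_obs_sdiff_union hB (Finset.mem_powerset.1 hη) ω ζ]
  simp_rw [hpt]
  rw [integral_sum_powerset_eq G p B hΦm hΦ1, blockCondProb_eq_real,
    ← integral_indicator_one (measurableSet_setOf_sdiff_union_obs_mem B' E ω)]
  refine integral_congr_ae (ae_of_all _ fun ζ => ?_)
  show {ζ | ω \ ↑B' ∪ ↑(obs ζ B') ∈ E}.indicator (1 : BondConfig V → ℝ) ζ =
    E.indicator 1 (ω \ ↑B' ∪ ↑(obs ζ B'))
  by_cases h : ω \ ↑B' ∪ ↑(obs ζ B') ∈ E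
  · rw [Set.indicator_of_mem h,
      Set.indicator_of_mem (show ζ ∈ {ζ | ω \ ↑B' ∪ ↑(obs ζ B') ∈ E} from h)]
    rfl
  · rw [Set.indicator_of_notMem h,
      Set.indicator_of_notMem (show ζ ∉ {ζ | ω \ ↑B' ∪ ↑(obs ζ B') ∈ E} from h)]

/-- **Conditional Harris for nested blocks, pointwise.** For `B ⊆ B'`, increasing events `A, A'` and every
`ω`: `P_p(A | ω off B') · P_p(A' | ω off B') ≤ Σ_{ξ ⊆ B'} P_p(obs B' = ξ) · P_p(A | (ω ∖ B' ∪ ξ) off B) ·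
P_p(A' | (ω ∖ B' ∪ ξ) off B)` — by the tower property both factors on the left are the `P_p(dζ)`-means of the
monotone `[0,1]`-valued functions `ζ ↦ P_p(A | (ω ∖ B' ∪ obs ζ B') off B)`, `ζ ↦ P_p(A' | … off B)`, and
Harris–FKG (`harris_fkg_integral_holds`) bounds the product of the means by the mean of the product, which is
the right-hand side (`integral_comp_obs_eq_sum`). -/
theorem blockCondProb_mul_blockCondProb_le_sum_of_subset {B B' : Finset (Sym2 V)} (hB : B ⊆ B')
    {A A' : Set (BondConfig V)} (hA : IsUpperSet A) (hA' : IsUpperSet A') (ω : BondConfig V) :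
    blockCondProb G p B' A ω * blockCondProb G p B' A' ω ≤
      ∑ ξ ∈ B'.powerset, (bondPercolation G p).real {ζ | obs ζ B' = ξ} *
        (blockCondProb G p B A (ω \ ↑B' ∪ ↑ξ) * blockCondProb G p B A' (ω \ ↑B' ∪ ↑ξ)) := by
  -- the two monotone functions of the sample `ζ`
  have hmono : ∀ {E : Set (BondConfig V)}, IsUpperSet E →
      Monotone fun ζ : BondConfig V => blockCondProb G p B E (ω \ ↑B' ∪ ↑(obs ζ B')) :=
    fun hE => (CornerBall.blockCondProb_mono G p B hE).comp (monotone_sdiff_union_obs B' ω)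
  have hL2 : ∀ E : Set (BondConfig V),
      MemLp (fun ζ : BondConfig V => blockCondProb G p B E (ω \ ↑B' ∪ ↑(obs ζ B'))) 2
        (bondPercolation G p) := fun E =>
    MemLp.of_bound (measurable_comp_obs B' (fun ξ => blockCondProb G p B E (ω \ ↑B' ∪ ↑ξ))).aestronglyMeasurable
      1 (ae_of_all _ fun ζ => by
        rw [Real.norm_eq_abs]
        exact abs_blockCondProb_le G p B E _)
  have hsum := integral_comp_obs_eq_sum G p B'
    fun ξ => blockCondProb G p B A (ω \ ↑B' ∪ ↑ξ) * blockCondProb G p B A' (ω \ ↑B' ∪ ↑ξ)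
  rw [← hsum, blockCondProb_eq_integral_of_subset G p hB A ω, blockCondProb_eq_integral_of_subset G p hB A' ω]
  exact harris_fkg_integral_holds G p (hmono hA) (hmono hA') (hL2 A) (hL2 A')

/-- The block average over `B'` of the product `P_p(A | · off B) · P_p(A' | · off B)` is integrable (a finite sum of
bounded measurable functions). -/
theorem integrable_sum_powerset_blockCondProb_mul (B B' : Finset (Sym2 V)) {A A' : Set (BondConfig V)}
    (hAm : MeasurableSet A) (hA'm : MeasurableSet A') :
    Integrable (fun ω : BondConfig V => ∑ ξ ∈ B'.powerset, (bondPercolation G p).real {ζ | obs ζ B' = ξ} *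
        (blockCondProb G p B A (ω \ ↑B' ∪ ↑ξ) * blockCondProb G p B A' (ω \ ↑B' ∪ ↑ξ)))
      (bondPercolation G p) := by
  have hm : Measurable fun ω => blockCondProb G p B A ω * blockCondProb G p B A' ω :=
    (measurable_blockCondProb G p B hAm).mul (measurable_blockCondProb G p B hA'm)
  refine Integrable.of_bound (Finset.measurable_sum _ fun ξ _ =>
      ((hm.comp (measurable_sdiff_union B' _)).const_mul _)).aestronglyMeasurable
    (∑ ξ ∈ B'.powerset, (1 : ℝ)) (ae_of_all _ fun ω => ?_)
  rw [Real.norm_eq_abs]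
  refine (Finset.abs_sum_le_sum_abs _ _).trans (Finset.sum_le_sum fun ξ _ => ?_)
  rw [abs_mul, abs_of_nonneg measureReal_nonneg, abs_mul]
  exact mul_le_one₀ measureReal_le_one (mul_nonneg (abs_nonneg _) (abs_nonneg _))
    (mul_le_one₀ (abs_blockCondProb_le G p B A _) (abs_nonneg _) (abs_blockCondProb_le G p B A' _))

end General

/-- **`integral_blockCondProb_mul_antitone`** (registered sub-goal of line `SketchIdeator1`, crux
stmt-CriticalPhenomena-7799, exact registered signature): **the harvested mixed moment is monotone under
coarsening of the window.**  For nested finite blocks `B ⊆ B'` of edges of a countable graph and increasing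
measurable events `A, A'`,
`∫ P_p(A | ω off B') P_p(A' | ω off B') dP_p(ω) ≤ ∫ P_p(A | ω off B) P_p(A' | ω off B) dP_p(ω)`:
conditional Harris for the nested blocks pointwise (`blockCondProb_mul_blockCondProb_le_sum_of_subset`),
integrated (`integral_mono`), and the resampling identity `∫ Σ_{ξ ⊆ B'} P_p(obs B' = ξ) F(ω ∖ B' ∪ ξ) dP_p = ∫ F dP_p`
(`integral_sum_powerset_eq`) for `F = P_p(A | · off B) P_p(A' | · off B)`. -/
theorem integral_blockCondProb_mul_antitone :
    ∀ {V : Type*} [Countable V] (G : SimpleGraph V) (p : unitInterval) {B B' : Finset (Sym2 V)}, B ⊆ B' →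
      ∀ {A A' : Set (BondConfig V)}, IsUpperSet A → IsUpperSet A' → MeasurableSet A → MeasurableSet A' →
      ∫ ω, blockCondProb G p B' A ω * blockCondProb G p B' A' ω ∂(bondPercolation G p) ≤
        ∫ ω, blockCondProb G p B A ω * blockCondProb G p B A' ω ∂(bondPercolation G p) := by
  intro V _ G p B B' hB A A' hA hA' hAm hA'm
  have hm : Measurable fun ω => blockCondProb G p B A ω * blockCondProb G p B A' ω :=
    (measurable_blockCondProb G p B hAm).mul (measurable_blockCondProb G p B hA'm)
  have hK : ∀ ω, |blockCondProb G p B A ω * blockCondProb G p B A' ω| ≤ 1 := fun ω => by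
    rw [abs_mul]
    exact mul_le_one₀ (abs_blockCondProb_le G p B A ω) (abs_nonneg _) (abs_blockCondProb_le G p B A' ω)
  rw [← integral_sum_powerset_eq G p B'
    (F := fun ω => blockCondProb G p B A ω * blockCondProb G p B A' ω) hm hK]
  exact integral_mono (integrable_blockCondProb_mul G p B' hAm hA'm)
    (integrable_sum_powerset_blockCondProb_mul G p B B' hAm hA'm)
    fun ω => blockCondProb_mul_blockCondProb_le_sum_of_subset G p hB hA hA' ω

end Summit.CriticalPhenomena.PercolationContinuityZ3.Theorems.TetrahedronHarrisGap

end
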